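import Summits.Ventures.PercRepro.C041TriangleUniversal

/-!
# THE SYMMETRIC SEED — `θ_△(v 1 + v 0, w)` in the cone for EVERY cone element `w` (mine-3, gen 61; C-041.md §21 (aq))

The universal-certificate LP of `C041TriangleUniversal` is infeasible for the single mark `v 1` alone on every pool
tried, but FEASIBLE for the symmetric sum `v 1 + v 0` (and for `v 1 + 2·X(1,1)`): `thetaTri_v1_add_v0_universal` is an
explicit 32-term identity over cone-valued linear maps of `w` (multiplications by `v 0`, `v 1`, `v ½`, the closure `ℓψ`,
and `φ(w)·G` with `φ ∈ {L₀, M₁, M₂, T₁, T₂, I₁, I₂, M₀, g − k}`), symmetrised by the mirror.  THEOREMS: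
`InCone_thetaTri_v1_add_v0 (hw : InCone w)`, equivalently `θ_△(v 1, w) + θ_△(v 0, w) ∈ cone`
(`InCone_thetaTri_v1_add_thetaTri_v0`), and with the rays `InCone_thetaTri_marks_sum`: `θ_△(X(p,0) + X(0,q), w) ∈ cone`
for all `p, q ≥ 1`.  What is still open is the single mark `v 1` by itself (the last seed of `InCone_thetaTri_marks_of_seeds`).
-/

namespace PercRepro

namespace RelaxedTriangle

open TreeClosure

/-- **THE UNIVERSAL SYMMETRIC-SEED IDENTITY** (exact LP over constants, tools/g61/unilp2.py, symmetrised). -/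
theorem thetaTri_v1_add_v0_universal (w : Vec6) :
    thetaTri (v 1 + v 0) w =
      (6 : ℝ) • w + (3 / 2 : ℝ) • ellv w + (3 / 8 : ℝ) • (ellv (v 0 * w) + ellv (v 1 * w))
      + (1 / 8 : ℝ) • (ellv (v 0 * v 0 * w) + ellv (v 1 * v 1 * w))
      + (6 * (w 0 - (w 4 + w 5 - w 3))) • v (1 / 2)
      + (4 * (w 2 - w 0)) • (v 0 * v (1 / 2)) + (4 * (w 1 - w 0)) • (v 1 * v (1 / 2))
      + (9 / 4 * w 3) • (v 0 + v 1) + (2 * (w 0 - (w 4 + w 5 - w 3))) • (v 1 * v 0)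
      + (2 * ((w 4 - w 3) + (w 5 - w 3))) • v (1 / 2)
      + (7 / 4 * (w 1 - w 0)) • v 1 + (7 / 4 * (w 2 - w 0)) • v 0
      + (3 / 2 * ((w 4 - w 3) + (w 5 - w 3))) • (1 : Vec6)
      + (5 / 4 * (w 4 - w 3)) • v 0 + (5 / 4 * (w 5 - w 3)) • v 1
      + ((w 4 - w 3) + (w 5 - w 3)) • (v 1 * v 0)
      + (3 / 4 * w 5) • v 1 + (3 / 4 * w 4) • v 0 + (3 / 4 * w 0) • (v 1 + v 0)
      + (1 / 2 * (w 5 - w 3)) • (v 0 * v 0) + (1 / 2 * (w 4 - w 3)) • (v 1 * v 1)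
      + (1 / 2 * (w 4 + w 5)) • (1 : Vec6) + (1 / 2 * w 4) • v 1 + (1 / 2 * w 5) • v 0 := by
  ext i
  simp only [thetaTri_eq_vec, Pi.add_apply, Pi.smul_apply, Pi.mul_apply, Pi.one_apply, smul_eq_mul, ellv, ell, v]
  fin_cases i <;> simp <;> ring

/-- **THE SYMMETRIC SEED AGAINST EVERY CONE ELEMENT.** -/
theorem InCone_thetaTri_v1_add_v0 {w : Vec6} (hw : InCone w) : InCone (thetaTri (v 1 + v 0) w) := by
  obtain ⟨h3, h34, h35, h01, h02, h0⟩ := InCone_coords hw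
  have hk := (K4v_of_InCone hw).k_le_g
  rw [thetaTri_v1_add_v0_universal]
  have hv10 : InCone (v 1 + v 0) := InCone_v1.add InCone_v0
  have hv01 : InCone (v 0 + v 1) := InCone_v0.add InCone_v1
  have he1 : InCone (ellv (v 0 * w) + ellv (v 1 * w)) :=
    (InCone_ellv (InCone_v0.mul hw)).add (InCone_ellv (InCone_v1.mul hw))
  have he2 : InCone (ellv (v 0 * v 0 * w) + ellv (v 1 * v 1 * w)) :=
    (InCone_ellv ((InCone_v0.mul InCone_v0).mul hw)).add (InCone_ellv ((InCone_v1.mul InCone_v1).mul hw))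
  refine (((((((((((((((((((((((InCone.smul _ (by norm_num) hw).add
    (InCone.smul _ (by norm_num) (InCone_ellv hw))).add
    (InCone.smul _ (by norm_num) he1)).add
    (InCone.smul _ (by norm_num) he2)).add
    (InCone.smul _ (by linarith) InCone_vh)).add
    (InCone.smul _ (by linarith) (InCone_v0.mul InCone_vh))).add
    (InCone.smul _ (by linarith) (InCone_v1.mul InCone_vh))).add
    (InCone.smul _ (by linarith) hv01)).add
    (InCone.smul _ (by linarith) (InCone_v1.mul InCone_v0))).add
    (InCone.smul _ (by linarith) InCone_vh)).add
    (InCone.smul _ (by linarith) InCone_v1)).add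
    (InCone.smul _ (by linarith) InCone_v0)).add
    (InCone.smul _ (by linarith) InCone_one)).add
    (InCone.smul _ (by linarith) InCone_v0)).add
    (InCone.smul _ (by linarith) InCone_v1)).add
    (InCone.smul _ (by linarith) (InCone_v1.mul InCone_v0))).add
    (InCone.smul _ (by linarith) InCone_v1)).add
    (InCone.smul _ (by linarith) InCone_v0)).add
    (InCone.smul _ (by linarith) hv10)).add
    (InCone.smul _ (by linarith) (InCone_v0.mul InCone_v0))).add
    (InCone.smul _ (by linarith) (InCone_v1.mul InCone_v1))).add
    (InCone.smul _ (by linarith) InCone_one)).add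
    (InCone.smul _ (by linarith) InCone_v1)).add
    (InCone.smul _ (by linarith) InCone_v0)

/-- `θ_△(v 1, w) + θ_△(v 0, w) ∈ cone` for every cone element `w`. -/
theorem InCone_thetaTri_v1_add_thetaTri_v0 {w : Vec6} (hw : InCone w) :
    InCone (thetaTri (v 1) w + thetaTri (v 0) w) := by
  rw [← thetaTri_add_left]
  exact InCone_thetaTri_v1_add_v0 hw

/-- **THE ONE-TYPE MARKED VERTICES IN SUM**: `θ_△(X(p,0) + X(0,q), w) ∈ cone` for all `p, q ≥ 1` and every cone
element `w` — the symmetric seed plus the two rays. -/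
theorem InCone_thetaTri_marks_sum (p q : ℕ) (hp : 1 ≤ p) (hq : 1 ≤ q) {w : Vec6} (hw : InCone w) :
    InCone (thetaTri (v 1 ^ p + v 0 ^ q) w) := by
  rw [pow_v_one_eq_add p hp, pow_v_zero_eq_add q hq]
  have e : v 1 + sh p • ![0, 1, 0, 0, 0, 0] + (v 0 + sh q • ![0, 0, 1, 0, 0, 0])
      = (v 1 + v 0) + sh p • ![0, 1, 0, 0, 0, 0] + sh q • ![0, 0, 1, 0, 0, 0] := by abel
  rw [e, thetaTri_add_left, thetaTri_add_left, thetaTri_smul_left, thetaTri_smul_left]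
  exact ((InCone_thetaTri_v1_add_v0 hw).add ((InCone_thetaTri_eT1 hw).smul _ (sh_nonneg p hp))).add
    ((InCone_thetaTri_eT2 hw).smul _ (sh_nonneg q hq))

end RelaxedTriangle

end PercRepro
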